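import Summits.BirchSwinnertonDyer.BirchSwinnertonDyer.Theorems.BiquadraticEisensteinDescentEisensteinHeartFlatCMInertBadKPrimeShapiroDatum
import HarnessLib

set_option linter.dupNamespace false -- `Summit.BirchSwinnertonDyer.BirchSwinnertonDyer.Theorems.…` (summit = sub)
set_option autoImplicit false

/-!
# Crux `EisensteinHeartFlatCMInertBadKPrime` (stmt-BirchSwinnertonDyer-21341), line `hsieh-lambda`, layer 2 (V3), part 9:
# the universally quantified sockets `(f, hf, h)` and `(δ, hδ)` of `…ShapiroDatum` are INHABITED

Route `BiquadraticEisensteinDescent` (cell `pub/bsd-wall`, width-prover seat `bsd-wall-cm-bed-w1` g5, D-0152 M1). The V3 theorems of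
`…ShapiroDatum` (p611673) quantify over ANY endomorphism `f` of `Sel_𝔭^Σ(K̄^{ker κ ∩ U}, E[p^∞])` that is `conj_γ` on classes, any
`h : IsLocNil p (f − 1)`, and any `Λ`-linear `δ` of `LocNilDual Sel f h` that is precomposition with the coefficient map `φ_*` (`hδ`).
So that a V4 typed «for all such `(f, h, δ)`» is not vacuous, this file records that the sockets are inhabited:

* `exists_conj_end` — `∃ f, (∀ s, ↑(f s) = conj_γ ↑s) ∧ IsLocNil p (f − 1)` (the codomain-restriction of `conj_γ`; local nilpotence
  by `ShapiroDatum.isLocNil_sel_inf`);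
* `exists_delta` — for every such `(f, h)` and every coefficient map `φ` commuting with `U ∋ γ` and anti-commuting off `U`:
  `∃ δ : LocNilDual Sel f h →ₗ[Λ] LocNilDual Sel f h, ∀ x s t, ↑t = φ_* ↑s → δ x s = x t` (`δ = LocNilDual.map h h (φ_*|Sel) _`,
  `Λ`-linear because `φ_*` commutes with `conj_γ`, `γ ∈ U`).

THEOREMS ONLY (no definition, no named fact, no instance, no `sorry`); imports no `Theses` module; nothing about V2/V4 or any case of
BSD is asserted; BSD is not proved by any of this. Supports stmt-BirchSwinnertonDyer-21341 as a helper.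

References: [GreenbergLNM1716] §1 (after Conj. 1.3); [Castella2018] §2.2; [SilvermanAEC2009] II.2.
-/

noncomputable section

open scoped Classical

namespace Summit.BirchSwinnertonDyer.BirchSwinnertonDyer.Theorems.BiquadraticEisensteinDescentEisensteinHeartFlatCMInertBadKPrimeShapiroDatumSockets

open NumberField IsDedekindDomain Field PowerSeries
  Literature.NumberTheory.EllipticCurves Literature.NumberTheory.EllipticCurves.GreenbergSelmer
  Literature.NumberTheory.EllipticCurves.IwasawaDual Literature.NumberTheory.GaloisRepresentations
  Summit.BirchSwinnertonDyer.Rank1Residual.X11b Summit.BirchSwinnertonDyer.Rank1Residual.X11b.AcSelmer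
  Summit.BirchSwinnertonDyer.BirchSwinnertonDyer.Theorems.BiquadraticEisensteinDescentDefs
  Summit.BirchSwinnertonDyer.BirchSwinnertonDyer.Theorems.BiquadraticEisensteinDescentEisensteinHeartFlatCMInertBadKPrimeSelmerTower
  Summit.BirchSwinnertonDyer.BirchSwinnertonDyer.Theorems.BiquadraticEisensteinDescentEisensteinHeartFlatCMInertBadKPrimeShapiroDatum

universe u

variable {K : Type u} [Field K] [NumberField K] (E : WeierstrassCurve K) {p : ℕ} [Fact p.Prime]
  (κ : ZpExtension K p) (𝔭 : HeightOneSpectrum (𝓞 K)) (S : Set (HeightOneSpectrum (𝓞 K)))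
  (U : Subgroup (absoluteGaloisGroup K)) [U.Normal]

/-- **The socket `(f, hf, h)` is inhabited**: the codomain-restriction of `conj_γ` to `Sel_𝔭^Σ(K̄^{ker κ ∩ U}, E[p^∞])` is `conj_γ` on
classes and `conj_γ − 1` is `p`-locally-nilpotent on it (`ShapiroDatum.isLocNil_sel_inf`). [cite: GreenbergLNM1716, §1 (after Conj. 1.3)] -/
theorem exists_conj_end (hp2 : p ≠ 2) (hU : IsOpen (U : Set (absoluteGaloisGroup K))) (hU2 : U.index = 2)
    {γ : absoluteGaloisGroup K} (hγ : κ.IsTopGenerator γ) (hγU : γ ∈ U) :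
    ∃ f : AddMonoid.End (selmerOver (κ.kerSubgroup ⊓ U) (E.geomPrimaryTorsion p) p 𝔭 S),
      (∀ s, ((f s : selmerOver (κ.kerSubgroup ⊓ U) (E.geomPrimaryTorsion p) p 𝔭 S) :
        subgroupH1 (κ.kerSubgroup ⊓ U) (E.geomPrimaryTorsion p)) = conjH1 (κ.kerSubgroup ⊓ U) (E.geomPrimaryTorsion p) γ s) ∧
      IsLocNil p (f - 1) := by
  let f : AddMonoid.End (selmerOver (κ.kerSubgroup ⊓ U) (E.geomPrimaryTorsion p) p 𝔭 S) :=
    ((conjH1 (κ.kerSubgroup ⊓ U) (E.geomPrimaryTorsion p) γ).restrict _).codRestrict _ (fun s ↦ conjH1_mem_selmerOver γ s.2)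
  have hf : ∀ s, ((f s : selmerOver (κ.kerSubgroup ⊓ U) (E.geomPrimaryTorsion p) p 𝔭 S) :
      subgroupH1 (κ.kerSubgroup ⊓ U) (E.geomPrimaryTorsion p)) = conjH1 (κ.kerSubgroup ⊓ U) (E.geomPrimaryTorsion p) γ s :=
    fun s ↦ rfl
  exact ⟨f, hf, isLocNil_sel_inf E κ 𝔭 S U hp2 hU hU2 hγ hγU f hf⟩

/-- **The socket `(δ, hδ)` is inhabited**: for `(f, hf, h)` as above and a coefficient map `φ` commuting with `U ∋ γ` and anti-commuting
off `U`, precomposition with `φ_*|_{Sel}` (`SelmerTower.resH1Hom_coeff_mem_selmerOver`) is a `Λ`-linear endomorphism `δ` of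
`LocNilDual Sel f h` (`LocNilDual.map`; `φ_*` commutes with `conj_γ` since `γ ∈ U`) with `δ x s = x (φ_* s)`. [cite: SilvermanAEC2009, II.2]
[cite: GreenbergLNM1716, §1 (after Conj. 1.3)] -/
theorem exists_delta {γ : absoluteGaloisGroup K} (hγU : γ ∈ U)
    (φ : E.geomPrimaryTorsion p →+ E.geomPrimaryTorsion p)
    (hφH' : ∀ (x : (κ.kerSubgroup ⊓ U : Subgroup (absoluteGaloisGroup K))) (m : E.geomPrimaryTorsion p), φ (x • m) = x • φ m)
    (hφU : ∀ σ ∈ U, ∀ m : E.geomPrimaryTorsion p, φ (σ • m) = σ • φ m)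
    (hφU' : ∀ σ, σ ∉ U → ∀ m : E.geomPrimaryTorsion p, φ (σ • m) = -(σ • φ m))
    (f : AddMonoid.End (selmerOver (κ.kerSubgroup ⊓ U) (E.geomPrimaryTorsion p) p 𝔭 S))
    (hf : ∀ s, ((f s : selmerOver (κ.kerSubgroup ⊓ U) (E.geomPrimaryTorsion p) p 𝔭 S) :
      subgroupH1 (κ.kerSubgroup ⊓ U) (E.geomPrimaryTorsion p)) = conjH1 (κ.kerSubgroup ⊓ U) (E.geomPrimaryTorsion p) γ s)
    (h : IsLocNil p (f - 1)) :
    ∃ δ : LocNilDual (selmerOver (κ.kerSubgroup ⊓ U) (E.geomPrimaryTorsion p) p 𝔭 S) f h →ₗ[IwasawaAlgebra p]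
        LocNilDual (selmerOver (κ.kerSubgroup ⊓ U) (E.geomPrimaryTorsion p) p 𝔭 S) f h,
      ∀ (x : LocNilDual (selmerOver (κ.kerSubgroup ⊓ U) (E.geomPrimaryTorsion p) p 𝔭 S) f h)
        (s t : selmerOver (κ.kerSubgroup ⊓ U) (E.geomPrimaryTorsion p) p 𝔭 S),
        (t : subgroupH1 (κ.kerSubgroup ⊓ U) (E.geomPrimaryTorsion p)) =
          resH1Hom (ContinuousMonoidHom.id _) φ hφH' (s : subgroupH1 (κ.kerSubgroup ⊓ U) (E.geomPrimaryTorsion p)) → δ x s = x t := by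
  have hφσ := coeff_comm_or_anticomm E U φ hφU hφU'
  -- `φ_*` restricted to the Selmer group
  let u : selmerOver (κ.kerSubgroup ⊓ U) (E.geomPrimaryTorsion p) p 𝔭 S →+
      selmerOver (κ.kerSubgroup ⊓ U) (E.geomPrimaryTorsion p) p 𝔭 S :=
    ((resH1Hom (ContinuousMonoidHom.id _) φ hφH').restrict _).codRestrict _
      (fun s ↦ resH1Hom_coeff_mem_selmerOver (E.geomPrimaryTorsion p) φ hφH' hφσ s.2)
  have hu_coe : ∀ s : selmerOver (κ.kerSubgroup ⊓ U) (E.geomPrimaryTorsion p) p 𝔭 S,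
      ((u s : selmerOver (κ.kerSubgroup ⊓ U) (E.geomPrimaryTorsion p) p 𝔭 S) :
        subgroupH1 (κ.kerSubgroup ⊓ U) (E.geomPrimaryTorsion p)) =
      resH1Hom (ContinuousMonoidHom.id _) φ hφH' (s : subgroupH1 (κ.kerSubgroup ⊓ U) (E.geomPrimaryTorsion p)) := fun s ↦ rfl
  -- `φ_*` commutes with `conj_γ` (`γ ∈ U`)
  have hu : ∀ s, f (u s) = u (f s) := fun s ↦ Subtype.ext (by
    rw [hf, hu_coe, hu_coe, hf, conjH1_resH1Hom_coeff_of_comm (E.geomPrimaryTorsion p) φ hφH' (hφU γ hγU)])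
  refine ⟨LocNilDual.map h h u hu, fun x s t hst ↦ ?_⟩
  rw [LocNilDual.map_apply]
  congr 1
  exact Subtype.ext (by rw [hu_coe]; exact hst.symm)

end Summit.BirchSwinnertonDyer.BirchSwinnertonDyer.Theorems.BiquadraticEisensteinDescentEisensteinHeartFlatCMInertBadKPrimeShapiroDatumSockets

end
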